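import Mathlib
import HarnessLib
import Summits.Ventures.LatticeQCDFlow.Exactness.SphereTransitive

/-!
# The rotation of a frame's axis towards a tangent vector, as a product of two Householder reflections in `SO(d)`

HONEST FRAMING: exact (Metropolis-corrected) sampling algorithms for lattice gauge theory;
figures of merit are autocorrelation/cost numbers at stated couplings and volumes; no
continuum-physics claim.

Venture `LatticeQCDFlow` (cell pub-lqcd), topic `Exactness`; FANOUT row 7 (`s0-cpn-null`: the
S0-D1 rung — 2D CP⁹ HMC and THMC with the molecular dynamics of Engel–Schaefer §2.2 on the site
spheres).  NEW WORK of the cell: elementary matrix algebra over Mathlib (`vecMulVec`, `dotProduct`)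
and row 9's `SphereTransitive.lean` (`householder`, `householder_mulVec`, `householder_mem_orthogonalGroup`,
`det_householder`).  Nothing is cited as a fact.  Printed counterpart, NAMED ONLY: Householder 1958;
the "two reflections make a rotation" lemma of plane geometry.

Purpose.  The geodesic drift of E–S eq. (11) on the unit sphere rotates the position `x` towards
the tangent momentum `π` by the angle `‖π‖ t` in the plane they span.  Seen from an orthonormal
FRAME `O ∈ SO(d)` with body axis `e` (`x = O e`) and body-frame tangential momentum `w` (`π = O w`),
the drift is the right translation `O ↦ O · R_t(w)` by the rotation constructed here
(`SphereDriftLift.lean` uses it to prove that the drift preserves `uniformSphere ⊗ Lebesgue` by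
right invariance of Haar measure — Liouville's theorem for the sphere leapfrog without a Jacobian).

## Content (`m` a finite index type, vectors `m → ℝ`, `e` a unit vector, `w ⊥ e`)

* `unitVec w = w/√(w·w)` (junk `0` at `w = 0`) and its bookkeeping; `householder_zero`.
* **`planeRot t e w = H_n · H_ŵ`** with `ŵ = unitVec w`, `n = −sin(θ/2) e + cos(θ/2) ŵ`,
  `θ = √(w·w) t`; `planeRot_zero_right` (`= 1` at `w = 0`).
* **`planeRot_mem_specialOrthogonalGroup`** — it lies in `SO(d)` (two reflections: determinant
  `(−1)² = 1`; at `w = 0` it is `1`).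
* **`planeRot_mulVec_axis`**: `R e = cos θ · e + (sin θ/√(w·w)) · w`;
  **`planeRot_mulVec_tangent`**: `R w = cos θ · w − (√(w·w) sin θ) · e` — the E–S eq. (11) pair.
* `continuousOn_unitVec`, `continuousOn_householder`, **`continuousOn_planeRot`** — continuity on
  `{w ⊥ e, w ≠ 0}` (the construction jumps at `w = 0`, where its VALUE is still the correct `1`;
  measurability of the frame lift is recovered from this in `SphereDriftLift.lean`).

NOT CLAIMED: the action of `planeRot` on the orthogonal complement of the plane (it is the
identity there, but nothing below needs it); `d = 1`.
-/

noncomputable section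

namespace Summit.Ventures.LatticeQCDFlow.Exactness

open Matrix Real

/-! ## The plane rotation in `SO(d)` as a product of two Householder reflections -/

section PlaneRot

variable {m : Type*} [Fintype m] [DecidableEq m]

/-- The unit vector of `w` (junk value `0` for `w = 0`). -/
def unitVec (w : m → ℝ) : m → ℝ := (Real.sqrt (w ⬝ᵥ w))⁻¹ • w

omit [DecidableEq m] in
/-- `unitVec 0 = 0`. -/
@[simp] theorem unitVec_zero : unitVec (0 : m → ℝ) = 0 := smul_zero _

omit [DecidableEq m] in
/-- `0 ≤ w·w` for a real vector. -/
theorem dotProduct_self_nonneg_real (w : m → ℝ) : 0 ≤ w ⬝ᵥ w :=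
  Finset.sum_nonneg fun i _ => mul_self_nonneg (w i)

omit [DecidableEq m] in
/-- The length `√(w·w)` is positive for `w ≠ 0`. -/
theorem sqrt_dotProduct_self_pos {w : m → ℝ} (hw : w ≠ 0) : 0 < Real.sqrt (w ⬝ᵥ w) :=
  Real.sqrt_pos.2 (lt_of_le_of_ne (dotProduct_self_nonneg_real w) (dotProduct_self_ne_zero hw).symm)

omit [DecidableEq m] in
/-- `(c / √(w·w)) • w = c • unitVec w`. -/
theorem div_sqrt_smul_eq (c : ℝ) (w : m → ℝ) : (c / Real.sqrt (w ⬝ᵥ w)) • w = c • unitVec w := by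
  rw [div_eq_mul_inv, mul_smul]; rfl

omit [DecidableEq m] in
/-- `√(w·w) • unitVec w = w`. -/
theorem sqrt_smul_unitVec (w : m → ℝ) : Real.sqrt (w ⬝ᵥ w) • unitVec w = w := by
  rcases eq_or_ne w 0 with rfl | hw
  · simp
  · rw [unitVec, smul_smul, mul_inv_cancel₀ (sqrt_dotProduct_self_pos hw).ne', one_smul]

omit [DecidableEq m] in
/-- `unitVec w` is a unit vector (`w ≠ 0`). -/
theorem unitVec_dotProduct_self {w : m → ℝ} (hw : w ≠ 0) : unitVec w ⬝ᵥ unitVec w = 1 := by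
  have hρ := sqrt_dotProduct_self_pos hw
  rw [unitVec, smul_dotProduct, dotProduct_smul, smul_eq_mul, smul_eq_mul, ← mul_assoc,
    ← mul_inv, Real.mul_self_sqrt (dotProduct_self_nonneg_real w),
    inv_mul_cancel₀ (dotProduct_self_ne_zero hw)]

omit [DecidableEq m] in
/-- `unitVec w · w = √(w·w)`. -/
theorem unitVec_dotProduct (w : m → ℝ) : unitVec w ⬝ᵥ w = Real.sqrt (w ⬝ᵥ w) := by
  rcases eq_or_ne w 0 with rfl | hw
  · simp
  · have hρ := sqrt_dotProduct_self_pos hw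
    rw [unitVec, smul_dotProduct, smul_eq_mul, inv_mul_eq_iff_eq_mul₀ hρ.ne',
      Real.mul_self_sqrt (dotProduct_self_nonneg_real w)]

omit [DecidableEq m] in
/-- `unitVec w` is orthogonal to whatever `w` is orthogonal to. -/
theorem unitVec_dotProduct_of_dotProduct_eq_zero {w e : m → ℝ} (hwe : w ⬝ᵥ e = 0) :
    unitVec w ⬝ᵥ e = 0 := by
  rw [unitVec, smul_dotProduct, hwe, smul_zero]

/-- `H_0 = 1` (junk value of the Householder matrix). -/
@[simp] theorem householder_zero : householder (0 : m → ℝ) = 1 := by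
  simp [householder]

/-- **The plane rotation.**  For a unit vector `e` and `w ⊥ e`: the rotation by the angle
`θ = √(w·w) t` in the oriented plane `(e, w)` (identity on its orthogonal complement), written as
"reflect in the hyperplane `w⊥`, then in the hyperplane orthogonal to `n = −sin(θ/2) e + cos(θ/2) ŵ`".
For `w = 0` it is `1`. -/
def planeRot (t : ℝ) (e w : m → ℝ) : Matrix m m ℝ :=
  householder ((-Real.sin (Real.sqrt (w ⬝ᵥ w) * t / 2)) • e +
      Real.cos (Real.sqrt (w ⬝ᵥ w) * t / 2) • unitVec w) * householder (unitVec w)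

/-- `planeRot t e 0 = 1`. -/
@[simp] theorem planeRot_zero_right (t : ℝ) (e : m → ℝ) : planeRot t e 0 = 1 := by
  simp [planeRot]

section Formulas

variable {t : ℝ} {e w : m → ℝ}

omit [DecidableEq m] in
/-- The second reflection vector `n = −sin a · e + cos a · ŵ` is a unit vector. -/
theorem rotNormal_dotProduct_self (he : e ⬝ᵥ e = 1) (hwe : w ⬝ᵥ e = 0) (hw : w ≠ 0) (a : ℝ) :
    ((-Real.sin a) • e + Real.cos a • unitVec w) ⬝ᵥ ((-Real.sin a) • e + Real.cos a • unitVec w) = 1 := by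
  have hu := unitVec_dotProduct_self hw
  have hue := unitVec_dotProduct_of_dotProduct_eq_zero hwe
  have heu : e ⬝ᵥ unitVec w = 0 := by rw [dotProduct_comm]; exact hue
  simp only [add_dotProduct, dotProduct_add, smul_dotProduct, dotProduct_smul, smul_eq_mul, he, hu,
    hue, heu]
  nlinarith [Real.sin_sq_add_cos_sq a]

omit [DecidableEq m] in
/-- `n · e = −sin a`. -/
theorem rotNormal_dotProduct_axis (he : e ⬝ᵥ e = 1) (hwe : w ⬝ᵥ e = 0) (a : ℝ) :
    ((-Real.sin a) • e + Real.cos a • unitVec w) ⬝ᵥ e = -Real.sin a := by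
  rw [add_dotProduct, smul_dotProduct, smul_dotProduct, he,
    unitVec_dotProduct_of_dotProduct_eq_zero hwe, smul_eq_mul, mul_one, smul_zero, add_zero]

omit [DecidableEq m] in
/-- `n · w = √(w·w) cos a`. -/
theorem rotNormal_dotProduct_tangent (hwe : w ⬝ᵥ e = 0) (a : ℝ) :
    ((-Real.sin a) • e + Real.cos a • unitVec w) ⬝ᵥ w = Real.sqrt (w ⬝ᵥ w) * Real.cos a := by
  have hew : e ⬝ᵥ w = 0 := by rw [dotProduct_comm]; exact hwe
  rw [add_dotProduct, smul_dotProduct, smul_dotProduct, hew, unitVec_dotProduct, smul_zero, zero_add,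
    smul_eq_mul, mul_comm]

/-- **`planeRot` is special orthogonal** (`e` a unit vector, `w ⊥ e`). -/
theorem planeRot_mem_specialOrthogonalGroup (t : ℝ) (he : e ⬝ᵥ e = 1) (hwe : w ⬝ᵥ e = 0) :
    planeRot t e w ∈ Matrix.specialOrthogonalGroup m ℝ := by
  rcases eq_or_ne w 0 with rfl | hw
  · rw [planeRot_zero_right]; exact one_mem _
  set a := Real.sqrt (w ⬝ᵥ w) * t / 2 with ha
  have hn : (-Real.sin a) • e + Real.cos a • unitVec w ≠ 0 := fun h0 => by
    have h1 := rotNormal_dotProduct_self he hwe hw a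
    rw [h0, dotProduct_zero] at h1
    exact zero_ne_one h1
  have hu : unitVec w ≠ 0 := fun h0 => by
    have h1 := unitVec_dotProduct_self hw
    rw [h0, dotProduct_zero] at h1
    exact zero_ne_one h1
  rw [Matrix.mem_specialOrthogonalGroup_iff]
  refine ⟨mul_mem (householder_mem_orthogonalGroup hn) (householder_mem_orthogonalGroup hu), ?_⟩
  rw [planeRot, det_mul, det_householder hn, det_householder hu]
  norm_num

/-- **The rotation moves the axis towards `w`**: `R e = cos θ · e + (sin θ / √(w·w)) · w`,
`θ = √(w·w) t`. -/
theorem planeRot_mulVec_axis (t : ℝ) (he : e ⬝ᵥ e = 1) (hwe : w ⬝ᵥ e = 0) :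
    planeRot t e w *ᵥ e =
      Real.cos (Real.sqrt (w ⬝ᵥ w) * t) • e + (Real.sin (Real.sqrt (w ⬝ᵥ w) * t) / Real.sqrt (w ⬝ᵥ w)) • w := by
  rcases eq_or_ne w 0 with rfl | hw
  · simp
  set a := Real.sqrt (w ⬝ᵥ w) * t / 2 with ha
  have h2a : Real.sqrt (w ⬝ᵥ w) * t = 2 * a := by rw [ha]; ring
  have hue := unitVec_dotProduct_of_dotProduct_eq_zero hwe
  have hsc := Real.sin_sq_add_cos_sq a
  rw [div_sqrt_smul_eq, planeRot, ← ha, ← mulVec_mulVec, householder_mulVec_of_orthogonal hue,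
    householder_mulVec, rotNormal_dotProduct_self he hwe hw, rotNormal_dotProduct_axis he hwe, h2a,
    Real.cos_two_mul, Real.sin_two_mul, div_one]
  ext i
  simp only [Pi.sub_apply, Pi.add_apply, Pi.smul_apply, smul_eq_mul]
  linear_combination (-2 * e i) * hsc

/-- **The rotation turns `w` back towards `−e`**: `R w = cos θ · w − (√(w·w) sin θ) · e`. -/
theorem planeRot_mulVec_tangent (t : ℝ) (he : e ⬝ᵥ e = 1) (hwe : w ⬝ᵥ e = 0) :
    planeRot t e w *ᵥ w =
      Real.cos (Real.sqrt (w ⬝ᵥ w) * t) • w - (Real.sqrt (w ⬝ᵥ w) * Real.sin (Real.sqrt (w ⬝ᵥ w) * t)) • e := by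
  rcases eq_or_ne w 0 with rfl | hw
  · simp
  set a := Real.sqrt (w ⬝ᵥ w) * t / 2 with ha
  have h2a : Real.sqrt (w ⬝ᵥ w) * t = 2 * a := by rw [ha]; ring
  have hHu : householder (unitVec w) *ᵥ w = -w := by
    rw [householder_mulVec, unitVec_dotProduct_self hw, unitVec_dotProduct, div_one, mul_smul,
      sqrt_smul_unitVec, two_smul]
    abel
  have hwi : ∀ i, w i = Real.sqrt (w ⬝ᵥ w) * unitVec w i := fun i => by
    conv_lhs => rw [← sqrt_smul_unitVec w]
    rfl
  rw [planeRot, ← ha, ← mulVec_mulVec, hHu, mulVec_neg, householder_mulVec,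
    rotNormal_dotProduct_self he hwe hw, rotNormal_dotProduct_tangent hwe, div_one, h2a,
    Real.cos_two_mul, Real.sin_two_mul]
  ext i
  simp only [Pi.sub_apply, Pi.add_apply, Pi.smul_apply, Pi.neg_apply, smul_eq_mul]
  rw [hwi i]
  ring

end Formulas

/-! ### Continuity away from `w = 0` -/

omit [DecidableEq m] in
/-- `w ↦ unitVec w` is continuous away from `0`. -/
theorem continuousOn_unitVec : ContinuousOn (unitVec : (m → ℝ) → m → ℝ) {0}ᶜ := by
  have h1 : ContinuousOn (fun w : m → ℝ => (Real.sqrt (w ⬝ᵥ w))⁻¹) {0}ᶜ :=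
    ContinuousOn.inv₀ ((continuous_id.dotProduct continuous_id).sqrt.continuousOn)
      (fun w hw => (sqrt_dotProduct_self_pos hw).ne')
  exact h1.smul continuousOn_id

/-- The Householder matrix depends continuously on `v ≠ 0`. -/
theorem continuousOn_householder : ContinuousOn (householder : (m → ℝ) → Matrix m m ℝ) {0}ᶜ := by
  have hc : ContinuousOn (fun v : m → ℝ => (2 : ℝ) / (v ⬝ᵥ v)) {0}ᶜ :=
    continuousOn_const.div (continuous_id.dotProduct continuous_id).continuousOn
      fun v hv => dotProduct_self_ne_zero hv
  have hV : Continuous fun v : m → ℝ => vecMulVec v v := continuous_id.matrix_vecMulVec continuous_id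
  exact continuousOn_const.sub (hc.smul hV.continuousOn)

/-- **`planeRot t e` is continuous away from `w = 0`.** -/
theorem continuousOn_planeRot (t : ℝ) {e : m → ℝ} (he : e ⬝ᵥ e = 1) :
    ContinuousOn (fun w : m → ℝ => planeRot t e w) {w | w ⬝ᵥ e = 0 ∧ w ≠ 0} := by
  have hsub : {w : m → ℝ | w ⬝ᵥ e = 0 ∧ w ≠ 0} ⊆ {0}ᶜ := fun w hw => hw.2
  have hρ : Continuous fun w : m → ℝ => Real.sqrt (w ⬝ᵥ w) := (continuous_id.dotProduct continuous_id).sqrt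
  have ha : Continuous fun w : m → ℝ => Real.sqrt (w ⬝ᵥ w) * t / 2 := (hρ.mul continuous_const).div_const _
  have hn : ContinuousOn (fun w : m → ℝ => (-Real.sin (Real.sqrt (w ⬝ᵥ w) * t / 2)) • e +
      Real.cos (Real.sqrt (w ⬝ᵥ w) * t / 2) • unitVec w) {w | w ⬝ᵥ e = 0 ∧ w ≠ 0} :=
    ((Real.continuous_sin.comp ha).neg.continuousOn.smul continuousOn_const).add
      ((Real.continuous_cos.comp ha).continuousOn.smul (continuousOn_unitVec.mono hsub))
  have hn0 : Set.MapsTo (fun w : m → ℝ => (-Real.sin (Real.sqrt (w ⬝ᵥ w) * t / 2)) • e +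
      Real.cos (Real.sqrt (w ⬝ᵥ w) * t / 2) • unitVec w) {w | w ⬝ᵥ e = 0 ∧ w ≠ 0} {0}ᶜ := by
    intro w hw h0
    have h1 := rotNormal_dotProduct_self he hw.1 hw.2 (Real.sqrt (w ⬝ᵥ w) * t / 2)
    have h0' := Set.mem_singleton_iff.1 h0
    simp only at h0'
    rw [h0', dotProduct_zero] at h1
    exact zero_ne_one h1
  have hu0 : Set.MapsTo (unitVec : (m → ℝ) → m → ℝ) {w | w ⬝ᵥ e = 0 ∧ w ≠ 0} {0}ᶜ := by
    intro w hw h0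
    have h1 := unitVec_dotProduct_self hw.2
    rw [Set.mem_singleton_iff.1 h0, dotProduct_zero] at h1
    exact zero_ne_one h1
  exact (continuousOn_householder.comp hn hn0).mul
    (continuousOn_householder.comp (continuousOn_unitVec.mono hsub) hu0)

end PlaneRot

end Summit.Ventures.LatticeQCDFlow.Exactness

end
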